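/-
Copyright: the b2b-balaban T⁴-continuum CRUX team, row NE7b owner lineage `t4-ne7b-p1` (gen 115). Project licence.
-/
import Summits.QuantumFields.BalabanUV.T4Continuum.Spine.NE7b.SupNextScalePropagator

/-!
# THE NEXT-SCALE OPERATOR IS INVERTIBLE ON `ℓ^∞(ℤ^d)` AND ITS INVERSE IS THE LOCALISED NEXT-SCALE PROPAGATOR: with the block
# covariance `Q′G′Q′*` and its inverse as OPERATORS on the coarse `ℓ^∞` (two-sided inverses of each other on bounded data), the
# multiplier response `R(w) = Q′∘(A + N′(σw))∘Dσ(w)` of the perturbed skeleton IS `(Q′G′Q′*)⁻¹∘(1 + S(w))` with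
# `S(w) = Q′G′P N′Dσ(w) + (Q′G′Q′*)(Q′N′Dσ(w))`, `‖S(w)‖ ≤ λK_D(2C_G + C_Q) =: θ₀`; for `θ₀ < 1` the Neumann series inverts `1 + S(w)`,
# so `R(w)u = f` has EXACTLY ONE solution `u ∈ ℓ^∞` for every `f ∈ ℓ^∞` — the existence half that (66)'s weighted a-priori letter
# left open; together: the next-scale propagator exists on `ℓ^∞` and is bounded between the weighted coarse spaces
# (row NE7b, node U5c; (66) + ASE §1 + Mathlib's geometric series in a complete normed ring BY NAME; [folklore])

Cell `pub-balaban`, sub-cell `t4`, spine estimate NE7b (`T4WeightBudget.RelWeightBound`; the cell's OWN estimate — NOT PRINTED in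
[Bałaban 1983–89], NOT PROVED).  Crux-route work under `Spine/NE7b/` by the row OWNER (`t4-ne7b-p1` gen 115) under FREEZE (0)'s
crux-prover clause (FILING-CLAIM C-ne7bp1-g115-6); NOTHING of Bałaban's is named as a Lean object, valued or asserted; no
`T4Continuum/Support` leaf typed; no `def`, no notation; zero `sorry`.  Imports (BY NAME): the owner's (66) `…SupNextScalePropagator`
(`weighted_kerQGQ`, `tsum_kerQGQ_Kinv_apply`, `nextScale_eq_propagatorForm`, `weighted_nextScale_inverse_apriori`; through it ASE
`exists_clm_of_letters`, `exists_clm_Gop`, (49) `abs_tsum_Gk_mul_le_sup`, (51) `summable_mul_Kinv_row`, `abs_blockAvg_le`, (58)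
`abs_apply_le_norm`, (62) `nonneg_of_weighted`), Literature `B5Hk103ScalarZd` (`Kinv`, `abs_Kinv_le`, `tsum_Kinv_mul_kerQGQ`,
`tsum_mul_tsum_comm`, `summable_expX`, `tsum_expX_le`), `B6QGQDecay237` (`abs_kerQGQ_le_unif`, `cU`, `cInv`, `deltaInv`), Mathlib
`geom_series_mul_neg` ∕ `mul_neg_geom_series` (Neumann series in the Banach algebra `ℓ^∞ →L ℓ^∞`).

WHY (located).  (66) proved the weighted a-priori letter for solutions of `R(w)u = f` and said «existence of a solution — invertibility
of `R(w)` on `ℓ^∞` — not claimed».  It is one Neumann series away: `R(w) = (Q′G′Q′*)⁻¹(1 + X) + Y` ((66) §2 as operators) and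
`(Q′G′Q′*)⁻¹∘(Q′G′Q′*) = 1 = (Q′G′Q′*)∘(Q′G′Q′*)⁻¹` on `ℓ^∞` (pv23's two entrywise identities + Fubini), so `R(w) = (Q′G′Q′*)⁻¹(1 + S)`,
`S = X + (Q′G′Q′*)Y`, and `‖S‖ < 1` for `λ` small.  This file types the four operators, the two inverse identities, the factorisation
and the bijection; (66) §3 then bounds THE solution in every weighted sup norm.

WHAT IS PROVED ([folklore]; `ℓ^∞ := lp (fun _ : X d => ℝ) ∞`; `C_Q := cU·K_d(δ_u)`, `C_K := cInv·K_d(δ_inv)`, `C_G := A_G·K_d(δ_u∕4)`):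
* §1 `abs_tsum_mul_Kinv_le` (`|Σ′_y f(y)(Q′G′Q′*)⁻¹(y₀,y)| ≤ C_K·R`), **`exists_clm_Kinv`**, **`exists_clm_kerQGQ`** (the two coarse
  kernel operators as `ℓ^∞ →L ℓ^∞` with displayed actions and norms `≤ C_K`, `≤ C_Q`), `tsum_Kinv_kerQGQ_apply`
  (`(Q′G′Q′*)⁻¹((Q′G′Q′*)f) = f` on bounded `f`), **`kinv_comp_ker`**, **`ker_comp_kinv`** (`= 1` as operators, for ANY operators with
  the displayed actions).
* §2 `norm_le_of_rows` helpers: `‖Q′‖ ≤ 1`, `‖P‖ ≤ 2`, `‖N′‖ ≤ λ` from the displayed actions (any operators).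
* §3 **`nextScale_eq_kinv_comp`** (`d ≥ 3`): for `Q′, A, P, G′` with the displayed actions, `N′ = g·`, a response `D` with `Q′∘D = 1`
  and the fibre equation, and the two coarse operators of §1: `Q′∘(A + N′)∘D = K⁻¹∘(1 + S)`,
  `S := Q′∘G′∘P∘N′∘D + (Q′G′Q′*)∘Q′∘N′∘D` ((66) `nextScale_eq_propagatorForm` read as an operator identity).
* §4 **`nextScale_existsUnique`** (`d ≥ 3`; `‖D‖ ≤ K_D`, `|g| ≤ λ`, `θ₀ := λK_D(2C_G + C_Q) < 1`): for every `f ∈ ℓ^∞` there is EXACTLY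
  ONE `u ∈ ℓ^∞` with `Q′(A(Du) + N′(Du)) = f` — `u = (Σ_i (−S)^i)((Q′G′Q′*)f)`; its sizes are (66) §3's letters.
* §5 toy.

HONEST (what this is NOT).  Constants existential ∕ useless by value; `θ₀ < 1` is an explicit-in-form but symbolic smallness condition
on `λ`; the next chart itself (its section ∕ fibre inverse and THEIR decay at the next level) is NOT here; scalar `ℤ^d` skeleton, whole
lattice, not the torus, not the covariant operators ((A3), NC-NE7b-α UNRULED); nothing of Bałaban's (A1c).  BY-NAME EFFECT ON THE WALL:
NONE.  NE7b NOT PRINTED ∕ NOT PROVED; spine PROVED 0∕9; rung (B)+1 on a FINITE torus — NOT infinite volume, NOT the mass gap, NOT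
Clay.  HONEST DEPENDENCY: continuum YM on T⁴ ⇐ BetaPertH ∧ nine spine estimates (0∕9 proved); BetaPertH ⇐ (D1) ∧ (D4) ∧ CAP+tail;
G-an2-4 gates asym, D1 and NE2∕3∕4.
-/

set_option autoImplicit false

noncomputable section

namespace Summit.QuantumFields.BalabanUV.T4Continuum.NE7b.SupNextScalePropagatorExists

open scoped ENNReal
open Literature.MathematicalPhysics.QuantumFieldTheory.Balaban1983to89
open B4Sect5Proof (latticeConst latticeConst_nonneg)
open B6QGQLower276 (X blk B mem_B AX kerQGQ)
open B6QGQDecay237 (deltaU deltaU_pos cU cU_pos cInv cInv_pos deltaInv deltaInv_pos abs_kerQGQ_le_unif)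
open B5Hk103ScalarZd (Gk Kinv nbhd summable_expX tsum_expX_le tsum_mul_tsum_comm abs_Kinv_le tsum_Kinv_mul_kerQGQ)
open Summit.QuantumFields.BalabanUV.Beta.D1BFx.PointColumnSplit (cKL cG0 cSplit)
open Summit.QuantumFields.BalabanUV.Beta.D1BFx.PointColumnDecay (cFar)
open BlockPropagatorSupNorm (abs_tsum_Gk_mul_le_sup supConstG_nonneg)
open FibreInverseSupNorm (summable_mul_Kinv_row abs_blockAvg_le)
open AugmentedSupEquivalence (exists_clm_of_letters exists_clm_Gop)
open LocalNemytskiiSup (abs_apply_le_norm)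
open OneShotChartWeightedRows (nonneg_of_weighted)
open SupNextScalePropagator (weighted_kerQGQ tsum_kerQGQ_Kinv_apply nextScale_eq_propagatorForm)

variable {d : ℕ}

/-! ## §1. The two coarse kernel operators and their two-sided inverse identities -/

/-- The row letter of `(Q′G′Q′*)⁻¹`: `|Σ′_y f(y)(Q′G′Q′*)⁻¹(y₀,y)| ≤ cInv·K_d(δ_inv)·R` for `|f| ≤ R` (pv23's `abs_Kinv_le`). [folklore] -/
theorem abs_tsum_mul_Kinv_le (n : ℕ) {a : ℝ} (ha : 0 < a) {f : X d → ℝ} {R : ℝ} (hf : ∀ y, |f y| ≤ R) (y₀ : X d) :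
    |∑' y : X d, f y * Kinv n a y₀ y| ≤ cInv d a * latticeConst d (deltaInv d a) * R := by
  have hR : 0 ≤ R := (abs_nonneg _).trans (hf y₀)
  have hδ := deltaInv_pos d ha
  have hc := (cInv_pos d ha).le
  have hmaj : Summable fun y : X d => cInv d a * R * Real.exp (-(deltaInv d a * dist y₀ y)) :=
    (summable_expX hδ y₀).mul_left _
  have h := tsum_of_norm_bounded hmaj.hasSum fun y => by
    rw [Real.norm_eq_abs, abs_mul]
    calc |f y| * |Kinv n a y₀ y| ≤ R * (cInv d a * Real.exp (-(deltaInv d a * dist y₀ y))) :=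
          mul_le_mul (hf y) (abs_Kinv_le n ha y₀ y) (abs_nonneg _) hR
      _ = cInv d a * R * Real.exp (-(deltaInv d a * dist y₀ y)) := by ring
  rw [Real.norm_eq_abs, tsum_mul_left] at h
  calc _ ≤ cInv d a * R * ∑' y : X d, Real.exp (-(deltaInv d a * dist y₀ y)) := h
    _ ≤ cInv d a * R * latticeConst d (deltaInv d a) := mul_le_mul_of_nonneg_left (tsum_expX_le hδ y₀) (by positivity)
    _ = _ := by ring

/-- **`(Q′G′Q′*)⁻¹` AS AN OPERATOR ON THE COARSE `ℓ^∞`**: `(K⁻¹f)(y₀) = Σ′_y f(y)(Q′G′Q′*)⁻¹(y₀,y)`, `‖K⁻¹‖ ≤ cInv·K_d(δ_inv)`. [folklore] -/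
theorem exists_clm_Kinv (n : ℕ) {a : ℝ} (ha : 0 < a) :
    ∃ T : lp (fun _ : X d => ℝ) ∞ →L[ℝ] lp (fun _ : X d => ℝ) ∞,
      (∀ (f : lp (fun _ : X d => ℝ) ∞) (y₀ : X d), T f y₀ = ∑' y : X d, f y * Kinv n a y₀ y) ∧
        ‖T‖ ≤ cInv d a * latticeConst d (deltaInv d a) := by
  refine exists_clm_of_letters (fun f y₀ => ∑' y : X d, f y * Kinv n a y₀ y)
    (fun f g Rf Rg hf hg y₀ => ?_) (fun r f R hf y₀ => ?_)
    (mul_nonneg (cInv_pos d ha).le (latticeConst_nonneg d (deltaInv_pos d ha).le))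
    fun f R hf y₀ => abs_tsum_mul_Kinv_le n ha hf y₀
  · rw [← (summable_mul_Kinv_row n ha hf y₀).tsum_add (summable_mul_Kinv_row n ha hg y₀)]
    exact tsum_congr fun y => by rw [Pi.add_apply]; ring
  · rw [← tsum_mul_left]
    exact tsum_congr fun y => by rw [Pi.smul_apply, smul_eq_mul]; ring

/-- **`Q′G′Q′*` AS AN OPERATOR ON THE COARSE `ℓ^∞`**: `(Kf)(z) = Σ′_y (Q′G′Q′*)(z,y)f(y)`, `‖K‖ ≤ cU·K_d(δ_u)` ((66) `weighted_kerQGQ`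
at the zero weight). [folklore] -/
theorem exists_clm_kerQGQ (n : ℕ) {a : ℝ} (ha : 0 < a) :
    ∃ T : lp (fun _ : X d => ℝ) ∞ →L[ℝ] lp (fun _ : X d => ℝ) ∞,
      (∀ (f : lp (fun _ : X d => ℝ) ∞) (z : X d), T f z = ∑' y : X d, kerQGQ n a z y * f y) ∧
        ‖T‖ ≤ cU d a * latticeConst d (deltaU d a) := by
  have hrow : ∀ (f : X d → ℝ) (R : ℝ), (∀ y, |f y| ≤ R) → ∀ z,
      |∑' y : X d, kerQGQ n a z y * f y| ≤ cU d a * latticeConst d (deltaU d a) * R := by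
    intro f R hf z
    have h := weighted_kerQGQ n ha (μ := 0) le_rfl (deltaU_pos d ha) (ρ := fun _ => 0)
      (fun _ _ => by rw [sub_self]; exact dist_nonneg) (f := f) (R := R)
      (fun y => by rw [zero_mul, Real.exp_zero, one_mul]; exact hf y) z
    rwa [zero_mul, Real.exp_zero, one_mul, sub_zero] at h
  have hsum : ∀ (f : X d → ℝ) (R : ℝ), (∀ y, |f y| ≤ R) → ∀ z, Summable fun y : X d => kerQGQ n a z y * f y := by
    intro f R hf z
    have hR : 0 ≤ R := (abs_nonneg _).trans (hf z)
    refine Summable.of_norm_bounded (((summable_expX (deltaU_pos d ha) z).mul_left (cU d a)).mul_right R) fun y => ?_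
    rw [Real.norm_eq_abs, abs_mul]
    exact mul_le_mul (abs_kerQGQ_le_unif n ha z y) (hf y) (abs_nonneg _) (by have := cU_pos d ha; positivity)
  refine exists_clm_of_letters (fun f z => ∑' y : X d, kerQGQ n a z y * f y)
    (fun f g Rf Rg hf hg z => ?_) (fun r f R hf z => ?_)
    (mul_nonneg (cU_pos d ha).le (latticeConst_nonneg d (deltaU_pos d ha).le)) hrow
  · rw [← (hsum f Rf hf z).tsum_add (hsum g Rg hg z)]
    exact tsum_congr fun y => by rw [Pi.add_apply]; ring
  · rw [← tsum_mul_left]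
    exact tsum_congr fun y => by rw [Pi.smul_apply, smul_eq_mul]; ring

/-- `(Q′G′Q′*)⁻¹((Q′G′Q′*)f) = f` on bounded `f`: `Σ′_y (Σ′_{y′}(Q′G′Q′*)(y,y′)f(y′))·(Q′G′Q′*)⁻¹(y₀,y) = f(y₀)` (Fubini + pv23's
`tsum_Kinv_mul_kerQGQ`). [folklore] -/
theorem tsum_Kinv_kerQGQ_apply (n : ℕ) {a : ℝ} (ha : 0 < a) {f : X d → ℝ} {R : ℝ} (hf : ∀ y, |f y| ≤ R) (y₀ : X d) :
    ∑' y : X d, (∑' y' : X d, kerQGQ n a y y' * f y') * Kinv n a y₀ y = f y₀ := by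
  classical
  have hR : 0 ≤ R := (abs_nonneg _).trans (hf y₀)
  have e1 : ∀ y : X d, (∑' y' : X d, kerQGQ n a y y' * f y') * Kinv n a y₀ y
      = Kinv n a y₀ y * ∑' y' : X d, kerQGQ n a y y' * f y' := fun y => mul_comm _ _
  simp_rw [e1]
  have hmaj : ∀ y y' : X d, |Kinv n a y₀ y * (kerQGQ n a y y' * f y')|
      ≤ cInv d a * cU d a * R * Real.exp (-(deltaInv d a * dist y₀ y)) * Real.exp (-(deltaU d a * dist y y')) := by
    intro y y'
    rw [abs_mul, abs_mul]
    have h1 := abs_Kinv_le n ha y₀ y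
    have h2 := abs_kerQGQ_le_unif n ha y y'
    have hc1 := (cU_pos d ha).le
    have hc2 := (cInv_pos d ha).le
    calc |Kinv n a y₀ y| * (|kerQGQ n a y y'| * |f y'|)
        ≤ (cInv d a * Real.exp (-(deltaInv d a * dist y₀ y))) * ((cU d a * Real.exp (-(deltaU d a * dist y y'))) * R) :=
          mul_le_mul h1 (mul_le_mul h2 (hf y') (abs_nonneg _) (by positivity)) (by positivity) (by positivity)
      _ = _ := by ring
  rw [tsum_mul_tsum_comm (C := cInv d a * cU d a * R) (deltaInv_pos d ha) (deltaU_pos d ha) y₀ hmaj]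
  have hinner : ∀ y' : X d, ∑' y : X d, Kinv n a y₀ y * (kerQGQ n a y y' * f y') = (if y₀ = y' then 1 else 0) * f y' := by
    intro y'
    have : ∀ y : X d, Kinv n a y₀ y * (kerQGQ n a y y' * f y') = f y' * (Kinv n a y₀ y * kerQGQ n a y y') := fun y => by ring
    simp_rw [this]
    rw [tsum_mul_left, tsum_Kinv_mul_kerQGQ n ha y₀ y', mul_comm]
  simp_rw [hinner]
  rw [tsum_eq_single y₀ (fun y' hy' => by rw [if_neg (Ne.symm hy'), zero_mul]), if_pos rfl, one_mul]

/-- **`K⁻¹∘K = 1`** on `ℓ^∞` for ANY operators with the displayed actions. [folklore] -/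
theorem kinv_comp_ker (n : ℕ) {a : ℝ} (ha : 0 < a) (KinvOp KerOp : lp (fun _ : X d => ℝ) ∞ →L[ℝ] lp (fun _ : X d => ℝ) ∞)
    (hKi : ∀ (f : lp (fun _ : X d => ℝ) ∞) (y₀ : X d), KinvOp f y₀ = ∑' y : X d, f y * Kinv n a y₀ y)
    (hKe : ∀ (f : lp (fun _ : X d => ℝ) ∞) (z : X d), KerOp f z = ∑' y : X d, kerQGQ n a z y * f y) :
    KinvOp.comp KerOp = ContinuousLinearMap.id ℝ (lp (fun _ : X d => ℝ) ∞) := by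
  refine ContinuousLinearMap.ext fun f => lp.ext (funext fun y₀ => ?_)
  rw [ContinuousLinearMap.comp_apply, ContinuousLinearMap.id_apply, hKi]
  have e : ∀ y, KerOp f y * Kinv n a y₀ y = (∑' y' : X d, kerQGQ n a y y' * f y') * Kinv n a y₀ y := fun y => by rw [hKe]
  rw [tsum_congr e]
  exact tsum_Kinv_kerQGQ_apply n ha (fun y => abs_apply_le_norm f y) y₀

/-- **`K∘K⁻¹ = 1`** on `ℓ^∞` for ANY operators with the displayed actions ((66) `tsum_kerQGQ_Kinv_apply`). [folklore] -/
theorem ker_comp_kinv (n : ℕ) {a : ℝ} (ha : 0 < a) (KinvOp KerOp : lp (fun _ : X d => ℝ) ∞ →L[ℝ] lp (fun _ : X d => ℝ) ∞)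
    (hKi : ∀ (f : lp (fun _ : X d => ℝ) ∞) (y₀ : X d), KinvOp f y₀ = ∑' y : X d, f y * Kinv n a y₀ y)
    (hKe : ∀ (f : lp (fun _ : X d => ℝ) ∞) (z : X d), KerOp f z = ∑' y : X d, kerQGQ n a z y * f y) :
    KerOp.comp KinvOp = ContinuousLinearMap.id ℝ (lp (fun _ : X d => ℝ) ∞) := by
  refine ContinuousLinearMap.ext fun f => lp.ext (funext fun z => ?_)
  rw [ContinuousLinearMap.comp_apply, ContinuousLinearMap.id_apply, hKe]
  have e : ∀ y, kerQGQ n a z y * KinvOp f y = kerQGQ n a z y * ∑' y' : X d, f y' * Kinv n a y y' := fun y => by rw [hKi]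
  rw [tsum_congr e]
  exact tsum_kerQGQ_Kinv_apply n ha (fun y => abs_apply_le_norm f y) z

/-! ## §2. Norms from displayed actions -/

/-- An operator whose displayed action is bounded sitewise by `C‖f‖` has norm `≤ C`. [folklore] -/
theorem opNorm_le_of_rows {C : ℝ} (hC : 0 ≤ C) (T : lp (fun _ : X d => ℝ) ∞ →L[ℝ] lp (fun _ : X d => ℝ) ∞)
    (h : ∀ (f : lp (fun _ : X d => ℝ) ∞) (p : X d), |T f p| ≤ C * ‖f‖) : ‖T‖ ≤ C :=
  ContinuousLinearMap.opNorm_le_bound _ hC fun f =>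
    lp.norm_le_of_forall_le (mul_nonneg hC (norm_nonneg f)) fun p => by rw [Real.norm_eq_abs]; exact h f p

/-! ## §3. The next-scale operator factorises through `(Q′G′Q′*)⁻¹` -/

/-- **`Q′∘(A + N′)∘D = K⁻¹∘(1 + S)`**, `S = Q′∘G′∘P∘N′∘D + K∘Q′∘N′∘D` (`d ≥ 3`): (66)'s propagator form read as an identity of
operators on `ℓ^∞`, for `Q′, A, P, G′, K = Q′G′Q′*, K⁻¹` with the displayed actions, `N′ = g·`, and a response `D` with `Q′∘D = 1` and
the fibre equation (`K⁻¹∘K = 1` absorbs the diagonal column). [folklore] -/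
theorem nextScale_eq_kinv_comp (hd : 3 ≤ d) (n : ℕ) {a : ℝ} (ha : 0 < a)
    (Dop Aop Pop Nop Gop D KinvOp KerOp : lp (fun _ : X d => ℝ) ∞ →L[ℝ] lp (fun _ : X d => ℝ) ∞)
    (hD : ∀ (f : lp (fun _ : X d => ℝ) ∞) (y : X d), Dop f y = (((n : ℝ) + 1) ^ d)⁻¹ * ∑ p ∈ B n y, f p)
    (hA : ∀ (f : lp (fun _ : X d => ℝ) ∞) (p : X d), Aop f p = ∑ r ∈ nbhd n p, AX n a p r * f r)
    (hP : ∀ (f : lp (fun _ : X d => ℝ) ∞) (p : X d), Pop f p = f p - (((n : ℝ) + 1) ^ d)⁻¹ * ∑ p' ∈ B n (blk n p), f p')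
    (hG : ∀ (f : lp (fun _ : X d => ℝ) ∞) (p : X d), Gop f p = ∑' q : X d, Gk n a p q * f q)
    (hDD : ∀ v : lp (fun _ : X d => ℝ) ∞, Dop (D v) = v)
    (hDfib : ∀ v : lp (fun _ : X d => ℝ) ∞, Pop (Aop (D v) + Nop (D v)) = 0)
    (hKi : ∀ (f : lp (fun _ : X d => ℝ) ∞) (y₀ : X d), KinvOp f y₀ = ∑' y : X d, f y * Kinv n a y₀ y)
    (hKe : ∀ (f : lp (fun _ : X d => ℝ) ∞) (z : X d), KerOp f z = ∑' y : X d, kerQGQ n a z y * f y) :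
    Dop.comp ((Aop + Nop).comp D)
      = KinvOp.comp (ContinuousLinearMap.id ℝ (lp (fun _ : X d => ℝ) ∞) + ((((Dop.comp Gop).comp Pop).comp Nop).comp D
          + (((KerOp.comp Dop).comp Nop).comp D))) := by
  classical
  refine ContinuousLinearMap.ext fun v => lp.ext (funext fun y₀ => ?_)
  have h := nextScale_eq_propagatorForm hd n ha Dop Aop Pop Nop hD hA hP (D v) v (hDD v) (hDfib v) y₀
  -- the three coarse functions and their boundedness
  have hψb : ∀ q, |Pop (Nop (D v)) q| ≤ ‖Pop (Nop (D v))‖ := fun q => abs_apply_le_norm _ q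
  have hGb := fun p => abs_tsum_Gk_mul_le_sup hd n ha hψb p
  have hXb : ∀ y, |v y + (((n : ℝ) + 1) ^ d)⁻¹ * ∑ p' ∈ B n y, ∑' q : X d, Gk n a p' q * Pop (Nop (D v)) q|
      ≤ ‖v‖ + ((cG0 d * cKL d (d - 2) + cSplit d a) * Real.exp (2 * deltaU d a)
          + cFar d a * Real.exp (4 * deltaU d a) / deltaU d a ^ 2) * latticeConst d (deltaU d a / 4)
            * ‖Pop (Nop (D v))‖ := fun y =>
    (abs_add_le _ _).trans (add_le_add (abs_apply_le_norm v y) (abs_blockAvg_le n hGb y))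
  have hKb : ∀ y, |KerOp (Dop (Nop (D v))) y| ≤ ‖KerOp (Dop (Nop (D v)))‖ := fun y => abs_apply_le_norm _ y
  have hs1 := summable_mul_Kinv_row n ha hXb y₀
  have hs2 := summable_mul_Kinv_row n ha hKb y₀
  have hKY : ∑' y : X d, KerOp (Dop (Nop (D v))) y * Kinv n a y₀ y = Dop (Nop (D v)) y₀ := by
    rw [tsum_congr (fun y => by rw [hKe])]
    exact tsum_Kinv_kerQGQ_apply n ha (fun y => abs_apply_le_norm _ y) y₀
  -- the summand of `K⁻¹((1 + S)v)` at `y`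
  have eT : ∀ y : X d, ((ContinuousLinearMap.id ℝ (lp (fun _ : X d => ℝ) ∞) + ((((Dop.comp Gop).comp Pop).comp Nop).comp D
        + (((KerOp.comp Dop).comp Nop).comp D))) v) y * Kinv n a y₀ y
      = (v y + (((n : ℝ) + 1) ^ d)⁻¹ * ∑ p' ∈ B n y, ∑' q : X d, Gk n a p' q * Pop (Nop (D v)) q) * Kinv n a y₀ y
        + KerOp (Dop (Nop (D v))) y * Kinv n a y₀ y := by
    intro y
    rw [_root_.add_apply, _root_.add_apply, ContinuousLinearMap.id_apply, lp.coeFn_add, lp.coeFn_add, Pi.add_apply, Pi.add_apply]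
    simp only [ContinuousLinearMap.comp_apply]
    rw [hD (Gop _) y, Finset.sum_congr rfl fun p' _ => hG _ p']
    ring
  rw [ContinuousLinearMap.comp_apply, ContinuousLinearMap.comp_apply, _root_.add_apply, h, ContinuousLinearMap.comp_apply, hKi,
    tsum_congr eT, hs1.tsum_add hs2, hKY]

/-! ## §4. Existence and uniqueness of the next-scale propagator on `ℓ^∞` -/

/-- **Neumann series, operator form**: for `S : E →L E` on a Banach space with `‖S‖ < 1` there is `B` with `B∘(1 + S) = 1 = (1 + S)∘B`
(Mathlib's `geom_series_mul_neg` ∕ `mul_neg_geom_series` in the Banach algebra `E →L E`, read as compositions). [folklore] -/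
theorem exists_two_sided_inverse_one_add {E : Type*} [NormedAddCommGroup E] [NormedSpace ℝ E] [CompleteSpace E]
    (S : E →L[ℝ] E) (hS : ‖S‖ < 1) :
    ∃ B : E →L[ℝ] E, B.comp (ContinuousLinearMap.id ℝ E + S) = ContinuousLinearMap.id ℝ E ∧
      (ContinuousLinearMap.id ℝ E + S).comp B = ContinuousLinearMap.id ℝ E := by
  have hS1 : ‖-S‖ < 1 := by rw [norm_neg]; exact hS
  have hB1 := geom_series_mul_neg (-S) hS1
  have hB2 := mul_neg_geom_series (-S) hS1
  rw [sub_neg_eq_add] at hB1 hB2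
  refine ⟨∑' i : ℕ, (-S) ^ i, ?_, ?_⟩
  · rw [← ContinuousLinearMap.one_def, ← ContinuousLinearMap.mul_def, hB1]
  · rw [← ContinuousLinearMap.one_def, ← ContinuousLinearMap.mul_def, hB2]

/-- **The perturbation is small**: `‖S‖ ≤ λ·K_D·(2C_G + C_Q)` for `S = Q′∘G′∘P∘N′∘D + K∘Q′∘N′∘D`, from the displayed actions
(`‖Q′‖ ≤ 1`, `‖P‖ ≤ 2`, `‖N′‖ ≤ λ`) and the norms `‖G′‖ ≤ C_G`, `‖K‖ ≤ C_Q`, `‖D‖ ≤ K_D`. [folklore] -/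
theorem norm_pert_le (n : ℕ) (Dop Pop Nop Gop D KerOp : lp (fun _ : X d => ℝ) ∞ →L[ℝ] lp (fun _ : X d => ℝ) ∞)
    (hD : ∀ (f : lp (fun _ : X d => ℝ) ∞) (y : X d), Dop f y = (((n : ℝ) + 1) ^ d)⁻¹ * ∑ p ∈ B n y, f p)
    (hP : ∀ (f : lp (fun _ : X d => ℝ) ∞) (p : X d), Pop f p = f p - (((n : ℝ) + 1) ^ d)⁻¹ * ∑ p' ∈ B n (blk n p), f p')
    {g : X d → ℝ} {lam : ℝ} (hN : ∀ (f : lp (fun _ : X d => ℝ) ∞) (p : X d), Nop f p = g p * f p) (hg : ∀ p, |g p| ≤ lam)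
    {CG CQ KD : ℝ} (hCG : 0 ≤ CG) (hCQ : 0 ≤ CQ) (hGn : ‖Gop‖ ≤ CG) (hKen : ‖KerOp‖ ≤ CQ) (hKD : ‖D‖ ≤ KD) :
    ‖((((Dop.comp Gop).comp Pop).comp Nop).comp D + (((KerOp.comp Dop).comp Nop).comp D))‖ ≤ lam * KD * (2 * CG + CQ) := by
  have hlam : 0 ≤ lam := (abs_nonneg _).trans (hg 0)
  have hDn : ‖Dop‖ ≤ 1 := opNorm_le_of_rows zero_le_one Dop fun f' y => by
    rw [hD, one_mul]; exact abs_blockAvg_le n (fun p => abs_apply_le_norm f' p) y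
  have hPn : ‖Pop‖ ≤ 2 := opNorm_le_of_rows zero_le_two Pop fun f' p => by
    rw [hP]
    calc _ ≤ |f' p| + |(((n : ℝ) + 1) ^ d)⁻¹ * ∑ p' ∈ B n (blk n p), f' p'| := abs_sub _ _
      _ ≤ ‖f'‖ + ‖f'‖ := add_le_add (abs_apply_le_norm f' p) (abs_blockAvg_le n (fun q => abs_apply_le_norm f' q) _)
      _ = 2 * ‖f'‖ := by ring
  have hNn : ‖Nop‖ ≤ lam := opNorm_le_of_rows hlam Nop fun f' p => by
    rw [hN, abs_mul]; exact mul_le_mul (hg p) (abs_apply_le_norm f' p) (abs_nonneg _) hlam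
  have hX1 : ‖Dop.comp Gop‖ ≤ 1 * CG := (ContinuousLinearMap.opNorm_comp_le _ _).trans (mul_le_mul hDn hGn (norm_nonneg _) zero_le_one)
  have hX2 : ‖(Dop.comp Gop).comp Pop‖ ≤ 1 * CG * 2 :=
    (ContinuousLinearMap.opNorm_comp_le _ _).trans (mul_le_mul hX1 hPn (norm_nonneg _) (by rw [one_mul]; exact hCG))
  have hX3 : ‖((Dop.comp Gop).comp Pop).comp Nop‖ ≤ 1 * CG * 2 * lam :=
    (ContinuousLinearMap.opNorm_comp_le _ _).trans
      (mul_le_mul hX2 hNn (norm_nonneg _) (by rw [one_mul]; exact mul_nonneg hCG zero_le_two))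
  have hX4 : ‖(((Dop.comp Gop).comp Pop).comp Nop).comp D‖ ≤ 1 * CG * 2 * lam * KD :=
    (ContinuousLinearMap.opNorm_comp_le _ _).trans
      (mul_le_mul hX3 hKD (norm_nonneg _) (by rw [one_mul]; exact mul_nonneg (mul_nonneg hCG zero_le_two) hlam))
  have hY1 : ‖KerOp.comp Dop‖ ≤ CQ * 1 := (ContinuousLinearMap.opNorm_comp_le _ _).trans (mul_le_mul hKen hDn (norm_nonneg _) hCQ)
  have hY2 : ‖(KerOp.comp Dop).comp Nop‖ ≤ CQ * 1 * lam :=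
    (ContinuousLinearMap.opNorm_comp_le _ _).trans (mul_le_mul hY1 hNn (norm_nonneg _) (by rw [mul_one]; exact hCQ))
  have hY3 : ‖((KerOp.comp Dop).comp Nop).comp D‖ ≤ CQ * 1 * lam * KD :=
    (ContinuousLinearMap.opNorm_comp_le _ _).trans
      (mul_le_mul hY2 hKD (norm_nonneg _) (by rw [mul_one]; exact mul_nonneg hCQ hlam))
  calc _ ≤ _ := norm_add_le _ _
    _ ≤ _ := add_le_add hX4 hY3
    _ = _ := by ring

/-- **THE NEXT-SCALE OPERATOR IS A BIJECTION OF THE COARSE `ℓ^∞`** (`d ≥ 3`; `‖D‖ ≤ K_D`, `|g| ≤ λ`,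
`θ₀ := λ·K_D·(2C_G + C_Q) < 1`): for `Q′, A, P` with the displayed actions, `N′ = g·`, and a response `D` with `Q′∘D = 1` and the fibre
equation, every `f ∈ ℓ^∞` has EXACTLY ONE `u ∈ ℓ^∞` with `Q′(A(Du) + N′(Du)) = f` (its size and its weighted sizes are (66) §3's
a-priori letters) — the Neumann series for `1 + S` in the Banach algebra `ℓ^∞ →L ℓ^∞` (`geom_series_mul_neg`, `mul_neg_geom_series`) composed with §1's two-sided
inverse pair. [folklore] -/
theorem nextScale_existsUnique (hd : 3 ≤ d) (n : ℕ) {a : ℝ} (ha : 0 < a)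
    (Dop Aop Pop Nop D : lp (fun _ : X d => ℝ) ∞ →L[ℝ] lp (fun _ : X d => ℝ) ∞)
    (hD : ∀ (f : lp (fun _ : X d => ℝ) ∞) (y : X d), Dop f y = (((n : ℝ) + 1) ^ d)⁻¹ * ∑ p ∈ B n y, f p)
    (hA : ∀ (f : lp (fun _ : X d => ℝ) ∞) (p : X d), Aop f p = ∑ r ∈ nbhd n p, AX n a p r * f r)
    (hP : ∀ (f : lp (fun _ : X d => ℝ) ∞) (p : X d), Pop f p = f p - (((n : ℝ) + 1) ^ d)⁻¹ * ∑ p' ∈ B n (blk n p), f p')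
    {g : X d → ℝ} {lam : ℝ} (hN : ∀ (f : lp (fun _ : X d => ℝ) ∞) (p : X d), Nop f p = g p * f p) (hg : ∀ p, |g p| ≤ lam)
    (hDD : ∀ v : lp (fun _ : X d => ℝ) ∞, Dop (D v) = v)
    (hDfib : ∀ v : lp (fun _ : X d => ℝ) ∞, Pop (Aop (D v) + Nop (D v)) = 0) {KD : ℝ} (hKD : ‖D‖ ≤ KD)
    (hθ : lam * KD * (2 * (((cG0 d * cKL d (d - 2) + cSplit d a) * Real.exp (2 * deltaU d a)
        + cFar d a * Real.exp (4 * deltaU d a) / deltaU d a ^ 2) * latticeConst d (deltaU d a / 4))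
          + cU d a * latticeConst d (deltaU d a)) < 1)
    (f : lp (fun _ : X d => ℝ) ∞) :
    ∃! u : lp (fun _ : X d => ℝ) ∞, Dop (Aop (D u) + Nop (D u)) = f := by
  obtain ⟨Gop, hG, hGn⟩ := exists_clm_Gop hd n ha
  obtain ⟨KinvOp, hKi, -⟩ := exists_clm_Kinv (d := d) n ha
  obtain ⟨KerOp, hKe, hKen⟩ := exists_clm_kerQGQ (d := d) n ha
  have hfac := nextScale_eq_kinv_comp hd n ha Dop Aop Pop Nop Gop D KinvOp KerOp hD hA hP hG hDD hDfib hKi hKe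
  obtain ⟨S, hS⟩ : ∃ S : lp (fun _ : X d => ℝ) ∞ →L[ℝ] lp (fun _ : X d => ℝ) ∞,
      S = ((((Dop.comp Gop).comp Pop).comp Nop).comp D + (((KerOp.comp Dop).comp Nop).comp D)) := ⟨_, rfl⟩
  rw [← hS] at hfac
  have hKK := kinv_comp_ker n ha KinvOp KerOp hKi hKe
  have hKK' := ker_comp_kinv n ha KinvOp KerOp hKi hKe
  -- `‖S‖ < 1`, then the two-sided Neumann inverse `B` of `1 + S`
  have hCG : 0 ≤ ((cG0 d * cKL d (d - 2) + cSplit d a) * Real.exp (2 * deltaU d a)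
      + cFar d a * Real.exp (4 * deltaU d a) / deltaU d a ^ 2) * latticeConst d (deltaU d a / 4) :=
    mul_nonneg (supConstG_nonneg d ha) (latticeConst_nonneg d (div_nonneg (deltaU_pos d ha).le zero_le_four))
  have hCQ : 0 ≤ cU d a * latticeConst d (deltaU d a) := mul_nonneg (cU_pos d ha).le (latticeConst_nonneg d (deltaU_pos d ha).le)
  have hSn := norm_pert_le n Dop Pop Nop Gop D KerOp hD hP hN hg hCG hCQ hGn hKen hKD
  rw [← hS] at hSn
  obtain ⟨Bop, hB1, hB2⟩ := exists_two_sided_inverse_one_add S (hSn.trans_lt hθ)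
  have hR : ∀ x : lp (fun _ : X d => ℝ) ∞, Dop (Aop (D x) + Nop (D x))
      = KinvOp ((ContinuousLinearMap.id ℝ (lp (fun _ : X d => ℝ) ∞) + S) x) := fun x => by
    have e := congrArg (fun T : lp (fun _ : X d => ℝ) ∞ →L[ℝ] lp (fun _ : X d => ℝ) ∞ => T x) hfac
    simpa only [ContinuousLinearMap.comp_apply, _root_.add_apply] using e
  refine ⟨Bop (KerOp f), ?_, fun u' hu' => ?_⟩
  · -- existence: `R(B(Kf)) = K⁻¹((1 + S)B(Kf)) = K⁻¹(Kf) = f`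
    have e1 : (ContinuousLinearMap.id ℝ (lp (fun _ : X d => ℝ) ∞) + S) (Bop (KerOp f)) = KerOp f := by
      rw [← ContinuousLinearMap.comp_apply (ContinuousLinearMap.id ℝ _ + S), hB2, ContinuousLinearMap.id_apply]
    beta_reduce
    rw [hR, e1, ← ContinuousLinearMap.comp_apply KinvOp KerOp, hKK, ContinuousLinearMap.id_apply]
  · -- uniqueness: `K∘K⁻¹ = 1` and `B∘(1 + S) = 1`
    have e1 : KinvOp ((ContinuousLinearMap.id ℝ (lp (fun _ : X d => ℝ) ∞) + S) u') = f := by rw [← hR]; exact hu'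
    have e2 : (ContinuousLinearMap.id ℝ (lp (fun _ : X d => ℝ) ∞) + S) u' = KerOp f := by
      have e := congrArg KerOp e1
      rwa [← ContinuousLinearMap.comp_apply KerOp KinvOp, hKK', ContinuousLinearMap.id_apply] at e
    have e3 := congrArg Bop e2
    rwa [← ContinuousLinearMap.comp_apply Bop, hB1, ContinuousLinearMap.id_apply] at e3

end Summit.QuantumFields.BalabanUV.T4Continuum.NE7b.SupNextScalePropagatorExists

end
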